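/- Copyright: the b2b-balaban cell (near-miss cell 7), T⁴-continuum fan-out, lineage t4-ne7b-p1 (node U5c COUNT
member).  Released under the licence of the surrounding project. -/
import Summits.QuantumFields.BalabanUV.T4Continuum.Support.HistoryGenealogyExtraction

/-!
# Genealogy extraction, part 2 (H3-(ID), combinatorial half): EVENT PRODUCTS, region counts and the one-step
PARTITION of the components along the extraction `HistoryGenealogyExtraction.ComponentHistory.pgen` (owner module of
row NE7b, lineage `t4-ne7b-p1` gen 39, ruling R-OWNER-39-1; re-open object (α), `SCOPE-alpha.md` §2 row 2 —
PRE-POSITIONING ONLY)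

Summits-side support leaf of the T⁴-continuum cell (rung (B)+1 on a FINITE torus only; NOT infinite volume, NOT the
mass gap, NOT the Clay statement; NOT a proof of the spine estimate NE7b, which is the cell's OWN estimate, NOT PRINTED
and NOT PROVED).  [folklore] finite combinatorics over `HistoryAdmissible.PGen` and part 1's `ComponentHistory`;
nothing printed is asserted, no `def … : Prop` fact of Bałaban's, no cite-tagged hypothesis, zero `sorry`.
B16 = [Balaban1989LargeFieldII] pp. 381–387 is a manuscript UNDER AUDIT; quoted sentences only LOCATE the printed
shapes (certified reading C-B16-6, `t4/T4-XREAD-NE7b-READING.md`; F-T4-47∕-49 of `t4/CITED-FACTS-T4.md`).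

WHAT IS DEFINED AND PROVED.
§4 EVENT PRODUCTS: `evProd fB fR : PGen γ → M` (births weighted by `fB step class region`, renewals by `fR h`, joins by
`1` — the SHAPE in which (1.79) p. 383 «Π_{j=1}^{k}Π_i exp(−½γ₀A₁²p₀²(g_j)(d′_j(Z_j^{(i)})+1) − 2p₀(g_j))·Π′exp(−p₀(g_j))»
attaches a factor to each new region and «the new factor exp(−p₀(g_j))» (p. 386) to each renewal, a merger carrying no
factor of its own) and **`evProd_pgen_succ`** (under `WF`, `c ∈ comp (j+1)`): the product of the genealogy of `c` is
the product of its parts' products, times the birth weights of its new regions, times `fR j` exactly in the renewal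
case — ONE-STEP MULTIPLICATIVITY, the re-indexing by which a product of per-(level, region) and per-renewal factors
becomes a product over the events of the extracted pedigrees (the shape of the `price`∕`pshapeTH` binder of
`WALL-NE7b-P1.md` §2); `evProd_pgen_succ_finset` (Finset form over the duplicate-free lists), `evProd_pgen_zero`;
`regions_pgen_succ`∕`regions_pgen_zero`: the constituent-region count likewise (ONE-STEP ADDITIVITY).
§5 THE ONE-STEP PARTITION of the components of level `j` (under `WF`): `continued H j` (those continued into some
component of level `j + 1` — a DISJOINT union over `comp (j+1)` of the part sets) and `died H j` (the rest: integrated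
out at step `j + 1`, the end of a maximal structure's life); `parent_unique` (an old component is continued into at
most one new component); **`prod_comp_eq_continued_mul_died`**: `∏_{a ∈ comp j} F a = (∏_{c ∈ comp (j+1)} ∏_{p ∈ parts
(j+1) c} F p) · ∏_{d ∈ died j} F d` (+ additive form, + `card_comp_eq`) — the telescoping step by which a product over
ALL (level, component) pairs re-indexes over the forest of maximal structures (live at the cutoff, or dead); and the two
BOOKING BOUNDS `sum_length_parts_le_card_comp`, `sum_length_news_le_card_newReg` (each old component ∕ each new region is
booked at most once per level — the entropy side counts births against `newReg j`); and **`forest_evProd_eq`** — THE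
FOREST IDENTITY: (Π over the genealogies of the components live at `K`) · (Π over those that died at each `j < K`) =
Π_{j ≤ K} Π_{c ∈ comp j} (renewal factor · birth weights of the new regions inside) — the global re-indexing M4 consumes.
§6 DECIDED SANITY: two regions born at step 0, one renewed at step 1, both merged with a third region at step 2 — the
extracted genealogy (`decide`), its `Adm 2`, region count `3`, root∕last step, event product `7000` for weights
`10^class`∕`7`, and the partition at level 1 (both continued, none dies).

HONEST.  Proves nothing of Bałaban's; BY-NAME EFFECT ON THE WALL: NONE today (pre-positioning for (α): the geometric
instantiation and the junction to `RealisedDomainsR` are the separate modules M3b ∕ M4 of `SCOPE-alpha.md` v2); NE7b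
NOT proved; spine 0∕9.  HONEST DEPENDENCY (cell): continuum YM on T⁴ ⇐ BetaPertH ∧ nine spine estimates (0/9 proved);
BetaPertH ⇐ (D1) ∧ (D4) ∧ CAP+tail; G-an2-4 gates asym, D1 and NE2/3/4.  This file changes none of it.
-/

open Finset
open Literature.MathematicalPhysics.QuantumFieldTheory.Balaban1983to89

namespace Summit.QuantumFields.BalabanUV.T4Continuum.HistoryGenealogyExtraction

open HistoryAdmissible HistoryAdmissible.PGen

/-! ## §4 Event products and constituent-region counts: one-step multiplicativity -/

section EvProd

variable {γ : Type*} {M : Type*} [CommMonoid M]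

/-- **THE EVENT PRODUCT** of a genealogy: births weighted by `fB step class region`, renewals by `fR h` (readiness
step `h`, event at `h + 1`), joins by `1` — the shape in which (1.79) p. 383 attaches «exp(−½γ₀A₁²p₀²(g_j)(d′_j(Z_j^{(i)})
+ 1) − 2p₀(g_j))» to each new region and «the new factor exp(−p₀(g_j))» (p. 386) to each renewal, a merger carrying no
factor of its own. [folklore] -/
def evProd (fB : ℕ → ℕ → γ → M) (fR : ℕ → M) : PGen γ → M
  | PGen.birth j d n => fB j d n
  | PGen.renew G h => fR h * evProd fB fR G
  | PGen.join X Y _ => evProd fB fR X * evProd fB fR Y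

variable (fB : ℕ → ℕ → γ → M) (fR : ℕ → M)

/-- event product of a birth [folklore] -/
@[simp] theorem evProd_birth (j d : ℕ) (n : γ) : evProd fB fR (PGen.birth j d n) = fB j d n := rfl

/-- event product of a renewal [folklore] -/
@[simp] theorem evProd_renew (G : PGen γ) (h : ℕ) : evProd fB fR (PGen.renew G h) = fR h * evProd fB fR G := rfl

/-- event product of a join [folklore] -/
@[simp] theorem evProd_join (X Y : PGen γ) (s : ℕ) :
    evProd fB fR (PGen.join X Y s) = evProd fB fR X * evProd fB fR Y := rfl

/-- the event product of a join chain is the product over the constituents [folklore] -/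
theorem evProd_joinTail (s : ℕ) : ∀ (T : PGen γ) (L : List (PGen γ)),
    evProd fB fR (joinTail T L s) = evProd fB fR T * (L.map (evProd fB fR)).prod
  | T, [] => by simp
  | T, U :: L => by simp [evProd_joinTail s U L]

/-- the event product of an assembled genealogy with a NONEMPTY constituent list: the product over the constituents,
times `fR h` exactly in the renewal case (one constituent, trigger set) [folklore] -/
theorem evProd_assemble (c : γ) (s h : ℕ) :
    ∀ (L : List (PGen γ)) (r : Bool), L ≠ [] →
      evProd fB fR (assemble c s h L r) =
        (if L.length = 1 ∧ r = true then fR h else 1) * (L.map (evProd fB fR)).prod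
  | [], _, hL => (hL rfl).elim
  | [T], r, _ => by cases r <;> simp [assemble]
  | T :: U :: L, r, _ => by simp [assemble, evProd_joinTail]

end EvProd

section Regions

variable {γ : Type*}

/-- the region count of a join chain is the sum over the constituents [folklore] -/
theorem regions_joinTail (s : ℕ) : ∀ (T : PGen γ) (L : List (PGen γ)),
    (joinTail T L s).regions = T.regions + (L.map PGen.regions).sum
  | T, [] => by simp
  | T, U :: L => by simp [regions, regions_joinTail s U L]

/-- the region count of an assembled genealogy with a nonempty constituent list is the sum over the constituents
[folklore] -/
theorem regions_assemble (c : γ) (s h : ℕ) :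
    ∀ (L : List (PGen γ)) (r : Bool), L ≠ [] → (assemble c s h L r).regions = (L.map PGen.regions).sum
  | [], _, hL => (hL rfl).elim
  | [T], r, _ => by cases r <;> simp [assemble, regions]
  | T :: U :: L, _, _ => by simp [assemble, regions, regions_joinTail]

/-- the region count of the births of a component is the number of its new regions [folklore] -/
theorem sum_regions_births {γ : Type*} [DecidableEq γ] (H : ComponentHistory γ) (s : ℕ) (c : γ) :
    ((H.news s c).map fun n => (PGen.birth s (H.cls n) n).regions).sum = (H.news s c).length := by
  generalize H.news s c = L
  induction L with
  | nil => rfl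
  | cons n L ih =>
      rw [List.map_cons, List.sum_cons, ih, List.length_cons]
      have h1 : (PGen.birth s (H.cls n) n).regions = 1 := rfl
      omega

end Regions

namespace ComponentHistory

variable {γ : Type*} [DecidableEq γ] (H : ComponentHistory γ)

/-- The RENEWAL CASE as a decidable proposition on the data: exactly one part, no new region, a new field.
[folklore] -/
def IsRenewal (s : ℕ) (c : γ) : Prop := (H.parts s c).length = 1 ∧ H.news s c = [] ∧ H.fieldIn s c = true

/-- `IsRenewal` is decidable [folklore] -/
instance (s : ℕ) (c : γ) : Decidable (H.IsRenewal s c) := inferInstanceAs (Decidable (_ ∧ _ ∧ _))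

/-- the renewal case ↔ one constituent and the trigger read [folklore] -/
theorem isRenewal_iff (rec : γ → PGen γ) (s : ℕ) (c : γ) :
    H.IsRenewal s c ↔ (H.constituents rec s c).length = 1 ∧ H.ren s c = true := by
  simp only [IsRenewal, length_constituents, ren, Bool.and_eq_true, decide_eq_true_eq]
  constructor
  · rintro ⟨h1, h2, h3⟩
    exact ⟨by simp [h1, h2], h2, h3⟩
  · rintro ⟨h1, h2, h3⟩
    refine ⟨?_, h2, h3⟩
    rw [h2, List.length_nil, Nat.add_zero] at h1
    exact h1

/-- **ONE-STEP MULTIPLICATIVITY OF THE EVENT PRODUCT** (under `WF`, for a component `c ∈ comp (j+1)`): the product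
of the genealogy of `c` is the product of its parts' products, times the birth weights of its new regions, times
`fR j` in the renewal case.  This is the re-indexing step by which a product of per-(level, region) and per-renewal
factors becomes a product over the events of the extracted pedigrees. [folklore] -/
theorem evProd_pgen_succ {M : Type*} [CommMonoid M] (fB : ℕ → ℕ → γ → M) (fR : ℕ → M) (hW : H.WF) (j : ℕ)
    (c : γ) (hc : c ∈ H.comp (j + 1)) :
    evProd fB fR (H.pgen (j + 1) c) =
      (if H.IsRenewal (j + 1) c then fR j else 1) *
        (((H.parts (j + 1) c).map fun p => evProd fB fR (H.pgen j p)).prod *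
          ((H.news (j + 1) c).map fun n => fB (j + 1) (H.cls n) n).prod) := by
  rw [pgen_succ_eq_assemble, evProd_assemble fB fR c (j + 1) j _ _ (H.constituents_ne_nil hW _ hc)]
  congr 1
  · simp only [← H.isRenewal_iff (H.pgen j) (j + 1) c]
  · rw [H.prod_map_constituents]
    rfl

/-- the same with FINSET products over the (duplicate-free) lists [folklore] -/
theorem evProd_pgen_succ_finset {M : Type*} [CommMonoid M] (fB : ℕ → ℕ → γ → M) (fR : ℕ → M) (hW : H.WF) (j : ℕ)
    (c : γ) (hc : c ∈ H.comp (j + 1)) :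
    evProd fB fR (H.pgen (j + 1) c) =
      (if H.IsRenewal (j + 1) c then fR j else 1) *
        ((∏ p ∈ (H.parts (j + 1) c).toFinset, evProd fB fR (H.pgen j p)) *
          ∏ n ∈ (H.news (j + 1) c).toFinset, fB (j + 1) (H.cls n) n) := by
  rw [H.evProd_pgen_succ fB fR hW j c hc, List.prod_toFinset _ (hW.parts_nodup _ _),
    List.prod_toFinset _ (hW.news_nodup _ _)]

/-- event product at level `0` (under `WF`, `c ∈ comp 0`): the birth weights of its new regions [folklore] -/
theorem evProd_pgen_zero {M : Type*} [CommMonoid M] (fB : ℕ → ℕ → γ → M) (fR : ℕ → M) (hW : H.WF) (c : γ)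
    (hc : c ∈ H.comp 0) :
    evProd fB fR (H.pgen 0 c) = ((H.news 0 c).map fun n => fB 0 (H.cls n) n).prod := by
  rw [pgen_zero_eq_assemble, evProd_assemble fB fR c 0 0 _ _ (H.births_zero_ne_nil hW hc)]
  simp only [Bool.false_eq_true, and_false, if_false, one_mul, births, List.map_map]
  rfl

/-- **ONE-STEP ADDITIVITY OF THE REGION COUNT** (under `WF`, `c ∈ comp (j+1)`): the constituent regions of the
genealogy of `c` are those of its parts plus its new regions. [folklore] -/
theorem regions_pgen_succ (hW : H.WF) (j : ℕ) (c : γ) (hc : c ∈ H.comp (j + 1)) :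
    (H.pgen (j + 1) c).regions =
      ((H.parts (j + 1) c).map fun p => (H.pgen j p).regions).sum + (H.news (j + 1) c).length := by
  rw [pgen_succ_eq_assemble, regions_assemble c (j + 1) j _ _ (H.constituents_ne_nil hW _ hc), H.sum_map_constituents,
    sum_regions_births]

/-- region count at level `0` (under `WF`, `c ∈ comp 0`): the number of its new regions [folklore] -/
theorem regions_pgen_zero (hW : H.WF) (c : γ) (hc : c ∈ H.comp 0) :
    (H.pgen 0 c).regions = (H.news 0 c).length := by
  rw [pgen_zero_eq_assemble, regions_assemble c 0 0 _ _ (H.births_zero_ne_nil hW hc), births, List.map_map]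
  exact sum_regions_births H 0 c

/-! ## §5 The one-step partition of the components of a level: continued ∪ died -/

/-- the components of level `j` CONTINUED into some component of level `j + 1` [folklore] -/
def continued (j : ℕ) : Finset γ := (H.comp (j + 1)).biUnion fun c => (H.parts (j + 1) c).toFinset

/-- the components of level `j` that DIE at step `j + 1` (continued into nothing: integrated out) [folklore] -/
def died (j : ℕ) : Finset γ := H.comp j \ H.continued j

/-- under `WF` the continued components are components [folklore] -/
theorem continued_subset (hW : H.WF) (j : ℕ) : H.continued j ⊆ H.comp j := by
  intro p hp
  simp only [continued, Finset.mem_biUnion, List.mem_toFinset] at hp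
  obtain ⟨c, hc, hpc⟩ := hp
  exact hW.parts_sub j c hc p hpc

/-- the died components are components [folklore] -/
theorem died_subset (j : ℕ) : H.died j ⊆ H.comp j := Finset.sdiff_subset

/-- continued and died are disjoint [folklore] -/
theorem disjoint_continued_died (j : ℕ) : Disjoint (H.continued j) (H.died j) := Finset.disjoint_sdiff

/-- under `WF` the components of level `j` are the continued ones and the died ones [folklore] -/
theorem continued_union_died (hW : H.WF) (j : ℕ) : H.continued j ∪ H.died j = H.comp j :=
  Finset.union_sdiff_of_subset (H.continued_subset hW j)

/-- **`parent_unique`** (under `WF`): an old component is continued into AT MOST ONE component of the next level.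
[folklore] -/
theorem parent_unique (hW : H.WF) {j : ℕ} {p c c' : γ} (hc : c ∈ H.comp (j + 1)) (hc' : c' ∈ H.comp (j + 1))
    (hp : p ∈ H.parts (j + 1) c) (hp' : p ∈ H.parts (j + 1) c') : c = c' := by
  by_contra hne
  exact Finset.disjoint_left.1 (hW.parts_disj j c c' hc hc' hne) (List.mem_toFinset.2 hp)
    (List.mem_toFinset.2 hp')

/-- under `WF` the family of part sets over the components of level `j + 1` is pairwise disjoint [folklore] -/
theorem pairwiseDisjoint_parts (hW : H.WF) (j : ℕ) :
    (↑(H.comp (j + 1)) : Set γ).PairwiseDisjoint fun c => (H.parts (j + 1) c).toFinset := by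
  intro c hc c' hc' hne
  exact hW.parts_disj j c c' hc hc' hne

/-- **THE TELESCOPING STEP** (under `WF`): a product over the components of level `j` is the product, over the
components of level `j + 1`, of the products over their parts, times the product over the components that die at
step `j + 1`.  Iterated from the final level downwards it re-indexes a product over ALL (level, component) pairs as a
product over the forest of maximal structures (live at the cutoff, or dead). [folklore] -/
theorem prod_comp_eq_continued_mul_died {M : Type*} [CommMonoid M] (hW : H.WF) (j : ℕ) (F : γ → M) :
    ∏ a ∈ H.comp j, F a = (∏ c ∈ H.comp (j + 1), ((H.parts (j + 1) c).map F).prod) * ∏ d ∈ H.died j, F d := by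
  rw [← H.continued_union_died hW j, Finset.prod_union (H.disjoint_continued_died j), continued,
    Finset.prod_biUnion (H.pairwiseDisjoint_parts hW j)]
  congr 1
  refine Finset.prod_congr rfl ?_
  intro c _
  exact List.prod_toFinset _ (hW.parts_nodup _ _)

/-- additive form of the telescoping step [folklore] -/
theorem sum_comp_eq_continued_add_died {M : Type*} [AddCommMonoid M] (hW : H.WF) (j : ℕ) (F : γ → M) :
    ∑ a ∈ H.comp j, F a = (∑ c ∈ H.comp (j + 1), ((H.parts (j + 1) c).map F).sum) + ∑ d ∈ H.died j, F d := by
  rw [← H.continued_union_died hW j, Finset.sum_union (H.disjoint_continued_died j), continued,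
    Finset.sum_biUnion (H.pairwiseDisjoint_parts hW j)]
  congr 1
  refine Finset.sum_congr rfl ?_
  intro c _
  exact List.sum_toFinset _ (hW.parts_nodup _ _)

/-- in particular (under `WF`) the number of components of level `j` is the total number of continued parts plus
the number of deaths [folklore] -/
theorem card_comp_eq (hW : H.WF) (j : ℕ) :
    (H.comp j).card = (∑ c ∈ H.comp (j + 1), (H.parts (j + 1) c).length) + (H.died j).card := by
  have h := H.sum_comp_eq_continued_add_died hW j (fun _ => (1 : ℕ))
  simpa [List.map_const', List.sum_replicate] using h

/-- under `WF` the number of continued parts booked over the components of level `j + 1` is at most the number of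
components of level `j` (each old component is continued at most once) [folklore] -/
theorem sum_length_parts_le_card_comp (hW : H.WF) (j : ℕ) :
    (∑ c ∈ H.comp (j + 1), (H.parts (j + 1) c).length) ≤ (H.comp j).card := by
  rw [H.card_comp_eq hW j]
  exact Nat.le_add_right _ _

/-- under `WF` the new regions booked inside the components of level `j` form a DISJOINT family inside `newReg j`;
hence the number of births booked at level `j` is at most the number of new regions of step `j` (each new region is
booked at most once — the entropy side counts births against `newReg`) [folklore] -/
theorem sum_length_news_le_card_newReg (hW : H.WF) (j : ℕ) :
    (∑ c ∈ H.comp j, (H.news j c).length) ≤ (H.newReg j).card := by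
  have hdisj : (↑(H.comp j) : Set γ).PairwiseDisjoint fun c => (H.news j c).toFinset := by
    intro c hc c' hc' hne
    exact hW.news_disj j c c' hc hc' hne
  have hsub : (H.comp j).biUnion (fun c => (H.news j c).toFinset) ⊆ H.newReg j := by
    intro n hn
    simp only [Finset.mem_biUnion, List.mem_toFinset] at hn
    obtain ⟨c, hc, hnc⟩ := hn
    exact hW.news_sub j c hc n hnc
  calc (∑ c ∈ H.comp j, (H.news j c).length)
      = ∑ c ∈ H.comp j, (H.news j c).toFinset.card := by
        refine Finset.sum_congr rfl ?_
        intro c _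
        exact (List.toFinset_card_of_nodup (hW.news_nodup j c)).symm
    _ = ((H.comp j).biUnion fun c => (H.news j c).toFinset).card := (Finset.card_biUnion hdisj).symm
    _ ≤ (H.newReg j).card := Finset.card_le_card hsub

/-- **THE FOREST IDENTITY** (under `WF`): the event products of the MAXIMAL structures — the genealogies of the
components live at the cutoff `K` and of every component that died earlier — multiply to the product over ALL levels
`j ≤ K` and all components of the booked per-step factors (renewal factor `fR (j−1)` in the renewal case, birth weights
of the new regions inside).  This is the global re-indexing «Π over (level, new region ∕ renewal) = Π over pedigrees of
Π over their events» that the junction M4 consumes ((1.79) p. 383 read per genealogy). [folklore] -/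
theorem forest_evProd_eq {M : Type*} [CommMonoid M] (fB : ℕ → ℕ → γ → M) (fR : ℕ → M) (hW : H.WF) : ∀ K : ℕ,
    (∏ c ∈ H.comp K, evProd fB fR (H.pgen K c)) *
        ∏ j ∈ Finset.range K, ∏ d ∈ H.died j, evProd fB fR (H.pgen j d) =
      ∏ j ∈ Finset.range (K + 1), ∏ c ∈ H.comp j,
        ((if H.IsRenewal j c then fR (j - 1) else 1) * ((H.news j c).map fun n => fB j (H.cls n) n).prod)
  | 0 => by
      rw [Finset.prod_range_zero, mul_one, Finset.prod_range_one]
      refine Finset.prod_congr rfl ?_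
      intro c hc
      have hnr : ¬ H.IsRenewal 0 c := by simp [IsRenewal, hW.parts_zero c]
      rw [if_neg hnr, one_mul, H.evProd_pgen_zero fB fR hW c hc]
  | K + 1 => by
      have ih := forest_evProd_eq fB fR hW K
      have hstep : ∏ c ∈ H.comp (K + 1), evProd fB fR (H.pgen (K + 1) c) =
          (∏ c ∈ H.comp (K + 1), ((if H.IsRenewal (K + 1) c then fR (K + 1 - 1) else 1) *
              ((H.news (K + 1) c).map fun n => fB (K + 1) (H.cls n) n).prod)) *
            ∏ c ∈ H.comp (K + 1), ((H.parts (K + 1) c).map fun p => evProd fB fR (H.pgen K p)).prod := by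
        rw [← Finset.prod_mul_distrib]
        refine Finset.prod_congr rfl ?_
        intro c hc
        rw [H.evProd_pgen_succ fB fR hW K c hc, Nat.add_sub_cancel]
        ac_rfl
      have htel := H.prod_comp_eq_continued_mul_died hW K (fun a => evProd fB fR (H.pgen K a))
      rw [Finset.prod_range_succ _ (K + 1), Finset.prod_range_succ _ K, hstep, ← ih, htel]
      ac_rfl

end ComponentHistory

/-! ## §6 Sanity, decided: two regions born at step 0, one renewed at step 1, all merged with a third at step 2 -/

namespace Sanity

open ComponentHistory

/-- THE TOY BOOKKEEPING over labels `ℕ`: level 0 — components `1, 2`, each a new region (classes `1`, `2`); level 1 —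
both continued alone, component `1` with a new field inside (renewal), component `2` without (no event); level 2 —
one component `5` continuing both and containing the new region `7` (class `0`), constituents listed leaf-first;
nothing afterwards. [folklore] -/
def toy : ComponentHistory ℕ where
  comp j := if j = 0 then {1, 2} else if j = 1 then {1, 2} else if j = 2 then {5} else ∅
  newReg j := if j = 0 then {1, 2} else if j = 2 then {7} else ∅
  cls n := if n = 1 then 1 else if n = 2 then 2 else 0
  constit j c :=
    if j = 0 ∧ c = 1 then [Sum.inr 1] else if j = 0 ∧ c = 2 then [Sum.inr 2]
    else if j = 1 ∧ c = 1 then [Sum.inl 1] else if j = 1 ∧ c = 2 then [Sum.inl 2]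
    else if j = 2 ∧ c = 5 then [Sum.inl 1, Sum.inl 2, Sum.inr 7] else []
  fieldIn j c := decide (j = 1 ∧ c = 1)

/-- the expected genealogy of the final component: the renewed line of region `1` joined with the line of region
`2` and the newborn region `7` at step `2` [folklore] -/
def expected : PGen ℕ :=
  PGen.join (PGen.renew (PGen.birth 0 1 1) 0) (PGen.join (PGen.birth 0 2 2) (PGen.birth 2 0 7) 2) 2

/-- the extraction computes the expected genealogy [folklore] -/
example : toy.pgen 2 5 = expected := by decide

/-- level 1: the renewal of component `1` and the no-event continuation of component `2` [folklore] -/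
example : toy.pgen 1 1 = PGen.renew (PGen.birth 0 1 1) 0 ∧ toy.pgen 1 2 = PGen.birth 0 2 2 := by decide

/-- the extracted genealogy obeys print's timing discipline up to the cutoff `2` [folklore] -/
example : expected.Adm 2 := by simp [expected, PGen.Adm, PGen.lastStep]

/-- it has `3` constituent regions, root step `0` and last step `2` [folklore] -/
example : expected.regions = 3 ∧ expected.rootStep = 0 ∧ expected.lastStep = 2 := by decide

/-- its event product with birth weights `10^class` and renewal weight `7`: `7 · 10 · 100 · 1 = 7000` [folklore] -/
example : evProd (fun _ d _ => (10 : ℕ) ^ d) (fun _ => 7) expected = 7000 := by decide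

/-- the one-step partition at level 1 → 2: both components are continued, none dies [folklore] -/
example : toy.continued 1 = {1, 2} ∧ toy.died 1 = ∅ := by decide

end Sanity

end Summit.QuantumFields.BalabanUV.T4Continuum.HistoryGenealogyExtraction
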